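import Literature.Topology.FourManifolds.TautFoliationsOffCollarRadial
import HarnessLib

/-!
# Levelled collar squares: the sign of the boundary heights relative to the ring height

Topic: the coned fence collar with a **general level function** (NOTES §52–§53 of the fact seat:
the radial level function of the collar disc must be perturbed near the grid vertices to put the
coned disc in general position, so the ring analysis has to work for a disc map of the form
`G x = Φ (angleParam c₀ x) (τf x)` with `τf` only *strictly monotone along the rays* from `c₀` on
the outer band and constant (`= tR`) on the ring `sphere c₀ R`, instead of the exact radial
formula). Polar centre `c₀`, outer radius `L`; the square is coned on a grid about `c₁`
(`P : ConePosition F G c₁ hL₁`, `TautFoliationsOffCollarRadial`).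

For a ring square `Q` (all its points at distance `∈ [7L/8, L - 2ℓ]` from `c₀`, meeting the ring):
the heights `r ↦ height_Q (G (rayPt c₀ y r))` along the rays through the points `y ∈ Q`, on the
radius range of `Q`, are strictly monotone with a direction uniform in `y`
(`strictMonoOn_rayHt_or`), equal to the radial height `radialHt' c₀ Q R` at `r = R`
(`rayHt_eq_radialHt_of_ring`), whence the **sign lemma**: on `∂Q`, `bdryHt < radialHt' R` iff
`dist (·) c₀ < R` (or iff `> R`, uniformly), and `bdryHt = radialHt' R` iff `dist (·) c₀ = R`
(`bdryHt_sign_or`); consequently the sub- and super-level arcs of `∂Q` at the ring height are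
preconnected (`isPreconnected_arcs_of_sign`, `isPreconnected_arcs_of_sign'`). This replaces
`ConeSquare.IsRadial` in the ring analysis.

* `SquareGrid.Grid.exists_adj_index`, `SquareGrid.Grid.exists_adj_mem_sq_of_dist_le` (**proved**);
* `ConeSquare.isPreconnected_arcs_of_sign`, `ConeSquare.isPreconnected_arcs_of_sign'` (**proved**);
* `ConePosition.apply_rayPt_mem_source`, `ConePosition.strictMonoOn_rayHt_or`,
  `ConePosition.rayHt_eq_radialHt_of_ring`, `ConePosition.bdryHt_sign_or` (**proved**).

All statements are [folklore].
-/

noncomputable section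

open Set Filter Metric Topology Function Real
open scoped unitInterval

namespace Literature.Topology.FourManifolds

/-! ## Squares adjacent to a given one cover its `3ℓ`-block -/

namespace SquareGrid.Grid

variable (g : Grid)

/-- One-dimensional adjacent indexing: a real in `[0, 2nℓ]` within `3ℓ` of the centre abscissa
of index `i` lies in the range of an index adjacent to `i`. [folklore] -/
theorem exists_adj_index {u : ℝ} (hu₀ : 0 ≤ u) (hun : u ≤ 2 * g.n * g.ℓ) (i : Fin g.n)
    (hclose : |u - (2 * (i : ℕ) + 1) * g.ℓ| ≤ 3 * g.ℓ) :
    ∃ i' : Fin g.n, (2 * (i' : ℕ) * g.ℓ ≤ u ∧ u ≤ (2 * (i' : ℕ) + 2) * g.ℓ) ∧ (i : ℕ) ≤ i' + 1 ∧ (i' : ℕ) ≤ i + 1 := by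
  have hℓ := g.hℓ
  rw [abs_le] at hclose
  obtain ⟨hc1, hc2⟩ := hclose
  by_cases h1 : u ≤ 2 * (i : ℕ) * g.ℓ
  · by_cases hi0 : (i : ℕ) = 0
    · refine ⟨i, ⟨?_, ?_⟩, by omega, by omega⟩
      · have : (2 * (i : ℕ) : ℝ) * g.ℓ = 0 := by rw [hi0]; simp
        linarith
      · have : (2 * (i : ℕ) : ℝ) * g.ℓ = 0 := by rw [hi0]; simp
        nlinarith
    · have hi1 : 1 ≤ (i : ℕ) := Nat.one_le_iff_ne_zero.2 hi0
      refine ⟨⟨(i : ℕ) - 1, by omega⟩, ⟨?_, ?_⟩, by simp only; omega, by simp only; omega⟩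
      · show 2 * (((i : ℕ) - 1 : ℕ) : ℝ) * g.ℓ ≤ u
        rw [Nat.cast_sub hi1]; push_cast; nlinarith
      · show u ≤ (2 * (((i : ℕ) - 1 : ℕ) : ℝ) + 2) * g.ℓ
        rw [Nat.cast_sub hi1]; push_cast; nlinarith
  · push Not at h1
    by_cases h2 : u ≤ (2 * (i : ℕ) + 2) * g.ℓ
    · exact ⟨i, ⟨h1.le, h2⟩, by omega, by omega⟩
    · push Not at h2
      have hin : (i : ℕ) + 1 < g.n := by
        by_contra hcon
        push Not at hcon
        have : (g.n : ℝ) ≤ (i : ℕ) + 1 := by exact_mod_cast hcon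
        nlinarith
      refine ⟨⟨(i : ℕ) + 1, hin⟩, ⟨?_, ?_⟩, by show (i : ℕ) ≤ (i : ℕ) + 1 + 1; omega, by show (i : ℕ) + 1 ≤ (i : ℕ) + 1; omega⟩
      · show 2 * (((i : ℕ) + 1 : ℕ) : ℝ) * g.ℓ ≤ u
        push_cast; linarith
      · show u ≤ (2 * (((i : ℕ) + 1 : ℕ) : ℝ) + 2) * g.ℓ
        push_cast; linarith

/-- **A point of the big square within `3ℓ` of the centre of a small square lies in a small
square adjacent to it.** [folklore] -/
theorem exists_adj_mem_sq_of_dist_le {x : ℝ × ℝ} (hx : x ∈ g.S) {q : Fin g.n × Fin g.n}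
    (hd : dist x (g.centre q) ≤ 3 * g.ℓ) : ∃ q', g.Adj q q' ∧ x ∈ g.sq q' := by
  rw [mem_S_iff] at hx
  rw [Prod.dist_eq, max_le_iff, Real.dist_eq, Real.dist_eq, centre_fst, centre_snd] at hd
  obtain ⟨i, hi, hi1, hi2⟩ := g.exists_adj_index (u := x.1 - g.a.1) (by linarith) (by linarith) q.1
    (by rw [show x.1 - g.a.1 - (2 * (q.1 : ℕ) + 1) * g.ℓ = x.1 - (g.a.1 + (2 * (q.1 : ℕ) + 1) * g.ℓ) by ring]; exact hd.1)
  obtain ⟨j, hj, hj1, hj2⟩ := g.exists_adj_index (u := x.2 - g.a.2) (by linarith) (by linarith) q.2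
    (by rw [show x.2 - g.a.2 - (2 * (q.2 : ℕ) + 1) * g.ℓ = x.2 - (g.a.2 + (2 * (q.2 : ℕ) + 1) * g.ℓ) by ring]; exact hd.2)
  exact ⟨(i, j), ⟨hi1, hi2, hj1, hj2⟩, (g.mem_sq_iff).2 ⟨by linarith [hi.1], by linarith [hi.2], by linarith [hj.1], by linarith [hj.2]⟩⟩

end SquareGrid.Grid

/-! ## Preconnected boundary arcs from the sign condition -/

namespace ConeSquare

open SquareGrid

/-- **Sign condition ⇒ preconnected arcs** (increasing case): if on the boundary square
`ψ < h ↔ dist (·) c₀ < R` and `ψ = h ↔ dist (·) c₀ = R`, then the sub-level arc `{ψ ≤ h}` is the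
piece of the boundary square inside the closed big square of radius `R` and the super-level arc
is the piece outside the open one; both are preconnected. [folklore] -/
theorem isPreconnected_arcs_of_sign {c₀ c : ℝ × ℝ} {ℓ R h : ℝ} {ψ : ℝ × ℝ → ℝ} (hℓ : 0 < ℓ) (hℓR : ℓ < R)
    (hs : ∀ y ∈ sphere c ℓ, (ψ y < h ↔ dist y c₀ < R) ∧ (ψ y = h ↔ dist y c₀ = R)) :
    IsPreconnected {y | y ∈ sphere c ℓ ∧ ψ y ≤ h} ∧ IsPreconnected {y | y ∈ sphere c ℓ ∧ h ≤ ψ y} := by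
  have h1 : {y | y ∈ sphere c ℓ ∧ ψ y ≤ h} = sphere c ℓ ∩ closedBall c₀ R := by
    ext y
    simp only [mem_setOf_eq, mem_inter_iff, mem_closedBall]
    constructor
    · rintro ⟨hy, hle⟩
      refine ⟨hy, ?_⟩
      rcases hle.lt_or_eq with hlt | heq
      · exact ((hs y hy).1.1 hlt).le
      · exact ((hs y hy).2.1 heq).le
    · rintro ⟨hy, hle⟩
      refine ⟨hy, ?_⟩
      rcases hle.lt_or_eq with hlt | heq
      · exact ((hs y hy).1.2 hlt).le
      · exact ((hs y hy).2.2 heq).le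
  have h2 : {y | y ∈ sphere c ℓ ∧ h ≤ ψ y} = sphere c ℓ ∩ (ball c₀ R)ᶜ := by
    ext y
    simp only [mem_setOf_eq, mem_inter_iff, mem_compl_iff, mem_ball, not_lt]
    constructor
    · rintro ⟨hy, hle⟩
      exact ⟨hy, not_lt.1 fun hlt ↦ (not_lt.2 hle) ((hs y hy).1.2 hlt)⟩
    · rintro ⟨hy, hle⟩
      exact ⟨hy, not_lt.1 fun hlt ↦ (not_lt.2 hle) ((hs y hy).1.1 hlt)⟩
  rw [h1, h2]
  exact ⟨isPreconnected_sphere_inter_closedBall hℓ hℓR, isPreconnected_sphere_diff_ball hℓ hℓR⟩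

/-- **Sign condition ⇒ preconnected arcs** (decreasing case: `ψ < h ↔ R < dist (·) c₀`).
[folklore] -/
theorem isPreconnected_arcs_of_sign' {c₀ c : ℝ × ℝ} {ℓ R h : ℝ} {ψ : ℝ × ℝ → ℝ} (hℓ : 0 < ℓ) (hℓR : ℓ < R)
    (hs : ∀ y ∈ sphere c ℓ, (ψ y < h ↔ R < dist y c₀) ∧ (ψ y = h ↔ dist y c₀ = R)) :
    IsPreconnected {y | y ∈ sphere c ℓ ∧ ψ y ≤ h} ∧ IsPreconnected {y | y ∈ sphere c ℓ ∧ h ≤ ψ y} := by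
  have h1 : {y | y ∈ sphere c ℓ ∧ ψ y ≤ h} = sphere c ℓ ∩ (ball c₀ R)ᶜ := by
    ext y
    simp only [mem_setOf_eq, mem_inter_iff, mem_compl_iff, mem_ball, not_lt]
    constructor
    · rintro ⟨hy, hle⟩
      refine ⟨hy, ?_⟩
      rcases hle.lt_or_eq with hlt | heq
      · exact ((hs y hy).1.1 hlt).le
      · exact ((hs y hy).2.1 heq).ge
    · rintro ⟨hy, hle⟩
      refine ⟨hy, ?_⟩
      rcases hle.lt_or_eq with hlt | heq
      · exact ((hs y hy).1.2 hlt).le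
      · exact ((hs y hy).2.2 heq.symm).le
  have h2 : {y | y ∈ sphere c ℓ ∧ h ≤ ψ y} = sphere c ℓ ∩ closedBall c₀ R := by
    ext y
    simp only [mem_setOf_eq, mem_inter_iff, mem_closedBall]
    constructor
    · rintro ⟨hy, hle⟩
      exact ⟨hy, not_lt.1 fun hlt ↦ (not_lt.2 hle) ((hs y hy).1.2 hlt)⟩
    · rintro ⟨hy, hle⟩
      exact ⟨hy, not_lt.1 fun hlt ↦ (not_lt.2 hle) ((hs y hy).1.1 hlt)⟩
  rw [h1, h2]
  exact ⟨isPreconnected_sphere_diff_ball hℓ hℓR, isPreconnected_sphere_inter_closedBall hℓ hℓR⟩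

end ConeSquare

/-! ## The levelled collar squares -/

namespace Foliation.ConePosition

open SquareGrid SquareGrid.Grid SquarePolar ConeSquare CollarRadius

variable {B : Type*} [NormedAddCommGroup B] [NormedSpace ℝ B] {M : Type*} [TopologicalSpace M] {F : Foliation B M}
variable {Γ : C(I, F.GermSpace)} {τ₀ ε : ℝ} {Φ : I → ℝ → M} {c₁ : ℝ × ℝ} {L₁ : ℝ} {hL₁ : 0 < L₁} {G : ℝ × ℝ → M}
variable (P : ConePosition F G c₁ hL₁) {c₀ : ℝ × ℝ} {L : ℝ}

omit [NormedSpace ℝ B] in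
/-- The ray point at the own distance is the point. [folklore] -/
theorem _root_.Literature.Topology.FourManifolds.CollarRadius.rayPt_dist {c₀ p : ℝ × ℝ} (hp : p ≠ c₀) :
    rayPt c₀ p (dist p c₀) = p := by
  have hd : dist p c₀ ≠ 0 := dist_ne_zero.2 hp
  rw [rayPt, div_self hd, one_smul, add_sub_cancel]

section Levelled

variable (hΦ : IsFenceOn F Γ τ₀ ε Φ univ) (hcl : ∀ τ ∈ Ioo (τ₀ - ε) (τ₀ + ε), Φ 1 τ = Φ 0 τ)
  {τf : ℝ × ℝ → ℝ} (hGτ : ∀ x, L / 2 ≤ dist x c₀ → G x = Φ (angleParam c₀ x) (τf x))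
  (hτadm : ∀ x, L / 2 ≤ dist x c₀ → τf x ∈ Ioo (τ₀ - ε) (τ₀ + ε))
  (hτc : Continuous τf)
  (hτmono : (∀ p, p ≠ c₀ → StrictMonoOn (fun r ↦ τf (rayPt c₀ p r)) (Icc (3 * L / 4) L)) ∨
    (∀ p, p ≠ c₀ → StrictAntiOn (fun r ↦ τf (rayPt c₀ p r)) (Icc (3 * L / 4) L)))
  (hGc : Continuous G) (hfit : dist c₀ c₁ + L ≤ L₁)
  {q : Fin P.n × Fin P.n} (hq : ∀ x ∈ P.gr.sq q, 7 * L / 8 ≤ dist x c₀ ∧ dist x c₀ ≤ L - 2 * P.gr.ℓ)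

include hq in
omit [NormedSpace ℝ B] in
/-- Elementary bounds for a levelled ring square: its points are not `c₀`, `ℓ ≤ L/16`, and the
radius range `[dist c_Q c₀ - ℓ, dist c_Q c₀ + ℓ]` lies in `[3L/4, L]`. [folklore] -/
theorem levelled_bounds : (∀ x ∈ P.gr.sq q, x ≠ c₀) ∧ P.gr.ℓ ≤ L / 16 ∧
    3 * L / 4 ≤ dist (P.gr.centre q) c₀ - P.gr.ℓ ∧ dist (P.gr.centre q) c₀ + P.gr.ℓ ≤ L := by
  have hℓ := P.gr.hℓ
  have hc := hq _ (P.gr.centre_mem_sq q)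
  -- a far point of the square
  have hfar : P.gr.centre q + ((P.gr.ℓ, 0) : ℝ × ℝ) ∈ P.gr.sq q := by
    show P.gr.centre q + ((P.gr.ℓ, 0) : ℝ × ℝ) ∈ closedBall (P.gr.centre q) P.gr.ℓ
    rw [mem_closedBall, dist_eq_norm, add_sub_cancel_left, Prod.norm_def, Real.norm_eq_abs, Real.norm_eq_abs,
      abs_of_pos hℓ, abs_zero, max_eq_left hℓ.le]
  have hnear : P.gr.centre q - ((P.gr.ℓ, 0) : ℝ × ℝ) ∈ P.gr.sq q := by
    show P.gr.centre q - ((P.gr.ℓ, 0) : ℝ × ℝ) ∈ closedBall (P.gr.centre q) P.gr.ℓ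
    rw [mem_closedBall, dist_eq_norm, sub_sub_cancel_left, norm_neg, Prod.norm_def, Real.norm_eq_abs,
      Real.norm_eq_abs, abs_of_pos hℓ, abs_zero, max_eq_left hℓ.le]
  have h1 := hq _ hfar
  have h2 := hq _ hnear
  -- `ℓ ≤ L/16`: the two points are `2ℓ` apart and both radii are in `[7L/8, L]`
  have hℓL : P.gr.ℓ ≤ L / 16 := by
    have hd : dist (P.gr.centre q + ((P.gr.ℓ, 0) : ℝ × ℝ)) (P.gr.centre q - ((P.gr.ℓ, 0) : ℝ × ℝ)) = 2 * P.gr.ℓ := by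
      rw [dist_eq_norm, show P.gr.centre q + ((P.gr.ℓ, 0) : ℝ × ℝ) - (P.gr.centre q - ((P.gr.ℓ, 0) : ℝ × ℝ)) =
        (((2 * P.gr.ℓ, 0) : ℝ × ℝ)) by ext <;> simp; ring, Prod.norm_def, Real.norm_eq_abs, Real.norm_eq_abs,
        abs_of_pos (by linarith), abs_zero, max_eq_left (by linarith)]
    have htri := abs_dist_sub_le (P.gr.centre q + ((P.gr.ℓ, 0) : ℝ × ℝ)) (P.gr.centre q - ((P.gr.ℓ, 0) : ℝ × ℝ)) c₀
    rw [hd] at htri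
    -- `2ℓ ≤ |d₁ - d₂| ≤`? no: we use `d ≤ L - 2ℓ` and `7L/8 ≤ d` for one point: `2ℓ ≤ L/8`
    linarith [h1.1, h1.2]
  refine ⟨fun x hx h ↦ ?_, hℓL, by linarith [hc.1], by linarith [hc.2]⟩
  have := (hq x hx).1
  rw [h, dist_self] at this
  linarith

include hfit hq in
omit [NormedSpace ℝ B] in
/-- **The ray points over a levelled ring square are in the source of its box**: for `y ∈ Q` and
`r` in the radius range of `Q`, `G (rayPt c₀ y r) ∈ (box Q).source` (the ray point is within
`2ℓ` of `y`, hence in an adjacent square). [folklore] -/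
theorem apply_rayPt_mem_source {y : ℝ × ℝ} (hy : y ∈ P.gr.sq q) {r : ℝ}
    (hr : r ∈ Icc (dist (P.gr.centre q) c₀ - P.gr.ℓ) (dist (P.gr.centre q) c₀ + P.gr.ℓ)) :
    G (rayPt c₀ y r) ∈ (P.box q).source := by
  obtain ⟨hne, hℓL, hlo, hhi⟩ := P.levelled_bounds hq
  have hℓ := P.gr.hℓ
  have hyne := hne y hy
  have hr0 : 0 ≤ r := by linarith [hr.1]
  -- the ray point is within `2ℓ` of `y`
  have hyq : dist y (P.gr.centre q) ≤ P.gr.ℓ := mem_closedBall.1 hy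
  have hdy : |dist y c₀ - dist (P.gr.centre q) c₀| ≤ P.gr.ℓ := (abs_dist_sub_le _ _ _).trans hyq
  have hzy : dist (rayPt c₀ y r) y ≤ 2 * P.gr.ℓ := by
    rw [dist_rayPt_self hyne, abs_le]
    rw [abs_le] at hdy
    constructor <;> linarith [hr.1, hr.2, hdy.1, hdy.2]
  have hzq : dist (rayPt c₀ y r) (P.gr.centre q) ≤ 3 * P.gr.ℓ := by
    linarith [dist_triangle (rayPt c₀ y r) y (P.gr.centre q)]
  -- and in the big square
  have hzS : rayPt c₀ y r ∈ P.gr.S := by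
    rw [show P.gr.S = closedBall c₁ L₁ from grid_S hL₁ P.hn, mem_closedBall]
    calc dist (rayPt c₀ y r) c₁ ≤ dist (rayPt c₀ y r) c₀ + dist c₀ c₁ := dist_triangle _ _ _
      _ ≤ L₁ := by rw [dist_rayPt hyne hr0]; linarith [hr.2]
  obtain ⟨q', hadj, hz⟩ := P.gr.exists_adj_mem_sq_of_dist_le hzS hzq
  exact F.subbox_subset_source (P.box_mem q) (P.apply_mem q q' hadj _ hz)

include hΦ hGτ hτadm hτc hτmono hGc hfit hq in
omit [NormedSpace ℝ B] in
/-- **The ray heights over a levelled ring square are strictly monotone** on the radius range,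
for each base point of the square. [folklore] -/
theorem strictMonoOn_or_strictAntiOn_rayHt {y : ℝ × ℝ} (hy : y ∈ P.gr.sq q) :
    StrictMonoOn (fun r ↦ height (P.box q) (G (rayPt c₀ y r))) (Icc (dist (P.gr.centre q) c₀ - P.gr.ℓ) (dist (P.gr.centre q) c₀ + P.gr.ℓ)) ∨
    StrictAntiOn (fun r ↦ height (P.box q) (G (rayPt c₀ y r))) (Icc (dist (P.gr.centre q) c₀ - P.gr.ℓ) (dist (P.gr.centre q) c₀ + P.gr.ℓ)) := by
  obtain ⟨hne, hℓL, hlo, hhi⟩ := P.levelled_bounds hq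
  have hℓ := P.gr.hℓ
  have hyne := hne y hy
  set a := dist (P.gr.centre q) c₀ - P.gr.ℓ with ha
  set b := dist (P.gr.centre q) c₀ + P.gr.ℓ with hb
  have hab : a ≤ b := by rw [ha, hb]; linarith
  have ha0 : 0 < a := by linarith
  have hsrc : ∀ r ∈ Icc a b, G (rayPt c₀ y r) ∈ (P.box q).source := fun r hr ↦ P.apply_rayPt_mem_source hfit hq hy hr
  -- continuity on `[a, b]`
  have hcont : ContinuousOn (fun r ↦ height (P.box q) (G (rayPt c₀ y r))) (Icc a b) := by
    have h1 : Continuous fun r ↦ G (rayPt c₀ y r) := hGc.comp (continuous_rayPt c₀ y)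
    have h2 : ContinuousOn (fun z ↦ height (P.box q) z) (P.box q).source := fun z hz ↦
      (continuous_snd.continuousAt.comp ((P.box q).continuousAt hz)).continuousWithinAt
    exact h2.comp h1.continuousOn hsrc
  refine strictMonoOn_or_strictAntiOn_of_locally_injOn hab hcont fun R₀ hR₀ ↦ ?_
  -- the formula through the fence on the ray: constant angle parameter `a⋆`, level `t r`
  set astar : I := angleParam c₀ y with hastar
  set t : ℝ → ℝ := fun r ↦ τf (rayPt c₀ y r) with ht
  have hform : ∀ r ∈ Icc a b, height (P.box q) (G (rayPt c₀ y r)) = height (P.box q) (Φ astar (t r)) := fun r hr ↦ by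
    have hrpos : 0 < r := ha0.trans_le hr.1
    rw [hGτ _ (by rw [dist_rayPt hyne hrpos.le]; linarith [hr.1]), angleParam_rayPt hyne hrpos]
  have htadm : ∀ r ∈ Icc a b, t r ∈ Ioo (τ₀ - ε) (τ₀ + ε) := fun r hr ↦ by
    have hrpos : 0 < r := ha0.trans_le hr.1
    exact hτadm _ (by rw [dist_rayPt hyne hrpos.le]; linarith [hr.1])
  have hsrc₀ : Φ astar (t R₀) ∈ (P.box q).source := by
    have h := hsrc R₀ hR₀
    rwa [hGτ _ (by rw [dist_rayPt hyne (ha0.trans_le hR₀.1).le]; linarith [hR₀.1]),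
      angleParam_rayPt hyne (ha0.trans_le hR₀.1)] at h
  obtain ⟨χ, ⟨κ, hκ, -, hχmono⟩, hev⟩ := hΦ.exists_height_germ (P.box_mem q) (htadm R₀ hR₀) hsrc₀
  have htc : Continuous t := hτc.comp (continuous_rayPt c₀ y)
  have hca : ContinuousAt (fun r ↦ ((astar, t r) : I × ℝ)) R₀ := continuousAt_const.prodMk htc.continuousAt
  have h1 : ∀ᶠ r in 𝓝 R₀, height (P.box q) (Φ astar (t r)) = χ (t r) := hca.eventually hev
  have h2 : ∀ᶠ r in 𝓝 R₀, t r ∈ Ioo (t R₀ - κ) (t R₀ + κ) :=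
    htc.continuousAt.preimage_mem_nhds (Ioo_mem_nhds (by linarith) (by linarith))
  obtain ⟨U, hU, hUsub⟩ : ∃ U ∈ 𝓝 R₀, ∀ r ∈ U, height (P.box q) (Φ astar (t r)) = χ (t r) ∧
      t r ∈ Ioo (t R₀ - κ) (t R₀ + κ) := by
    obtain ⟨U, hU, h⟩ := (h1.and h2).exists_mem
    exact ⟨U, hU, h⟩
  refine ⟨U, hU, fun r hr r' hr' hrr' ↦ ?_⟩
  have hχinj : InjOn χ (Ioo (t R₀ - κ) (t R₀ + κ)) := hχmono.elim StrictMonoOn.injOn StrictAntiOn.injOn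
  change height (P.box q) (G (rayPt c₀ y r)) = height (P.box q) (G (rayPt c₀ y r')) at hrr'
  rw [hform r hr.2, hform r' hr'.2, (hUsub r hr.1).1, (hUsub r' hr'.1).1] at hrr'
  have hteq : t r = t r' := hχinj (hUsub r hr.1).2 (hUsub r' hr'.1).2 hrr'
  -- `t` is injective on `[a, b] ⊆ [3L/4, L]`
  have hsub : Icc a b ⊆ Icc (3 * L / 4) L := Icc_subset_Icc hlo hhi
  have htinj : InjOn t (Icc (3 * L / 4) L) := by
    rcases hτmono with h | h
    · exact (h y hyne).injOn
    · exact (h y hyne).injOn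
  exact htinj (hsub hr.2) (hsub hr'.2) hteq

include hΦ hGτ hτadm hτc hτmono hGc hfit hq in
omit [NormedSpace ℝ B] in
/-- **The direction of the ray heights is uniform over the square**: either all the ray height
functions over `Q` are strictly increasing on the radius range, or all are strictly decreasing
(`Q` is connected and the ray heights are jointly continuous). [folklore] -/
theorem strictMonoOn_rayHt_or :
    (∀ y ∈ P.gr.sq q, StrictMonoOn (fun r ↦ height (P.box q) (G (rayPt c₀ y r)))
      (Icc (dist (P.gr.centre q) c₀ - P.gr.ℓ) (dist (P.gr.centre q) c₀ + P.gr.ℓ))) ∨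
    (∀ y ∈ P.gr.sq q, StrictAntiOn (fun r ↦ height (P.box q) (G (rayPt c₀ y r)))
      (Icc (dist (P.gr.centre q) c₀ - P.gr.ℓ) (dist (P.gr.centre q) c₀ + P.gr.ℓ))) := by
  obtain ⟨hne, hℓL, hlo, hhi⟩ := P.levelled_bounds hq
  have hℓ := P.gr.hℓ
  set a := dist (P.gr.centre q) c₀ - P.gr.ℓ with ha
  set b := dist (P.gr.centre q) c₀ + P.gr.ℓ with hb
  have hab : a < b := by rw [ha, hb]; linarith
  have haI : a ∈ Icc a b := ⟨le_rfl, hab.le⟩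
  have hbI : b ∈ Icc a b := ⟨hab.le, le_rfl⟩
  -- the difference of the ray heights at the two ends, continuous on the square
  set D : ℝ × ℝ → ℝ := fun y ↦ height (P.box q) (G (rayPt c₀ y b)) - height (P.box q) (G (rayPt c₀ y a)) with hD
  have hcontG : ∀ r ∈ Icc a b, ContinuousOn (fun y ↦ height (P.box q) (G (rayPt c₀ y r))) (P.gr.sq q) := by
    intro r hr y hy
    have hyne := hne y hy
    have h1 : ContinuousAt (fun y' ↦ rayPt c₀ y' r) y := by
      have : ContinuousAt (fun y' : ℝ × ℝ ↦ c₀ + (r / dist y' c₀) • (y' - c₀)) y :=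
        continuousAt_const.add (((continuousAt_const.div (continuous_id.dist continuous_const).continuousAt
          (dist_ne_zero.2 hyne))).smul (continuousAt_id.sub continuousAt_const))
      exact this
    have h2 : ContinuousAt G (rayPt c₀ y r) := hGc.continuousAt
    have h3 : ContinuousAt (fun z ↦ height (P.box q) z) (G (rayPt c₀ y r)) :=
      continuous_snd.continuousAt.comp ((P.box q).continuousAt (P.apply_rayPt_mem_source hfit hq hy hr))
    exact (ContinuousAt.comp_of_eq h3 (ContinuousAt.comp_of_eq h2 h1 rfl) rfl).continuousWithinAt
  have hDc : ContinuousOn D (P.gr.sq q) := (hcontG b hbI).sub (hcontG a haI)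
  have hDne : ∀ y ∈ P.gr.sq q, D y ≠ 0 := fun y hy h ↦ by
    have heq : height (P.box q) (G (rayPt c₀ y b)) = height (P.box q) (G (rayPt c₀ y a)) := sub_eq_zero.1 h
    rcases P.strictMonoOn_or_strictAntiOn_rayHt hΦ hGτ hτadm hτc hτmono hGc hfit hq hy with hm | hm
    · exact absurd heq (hm haI hbI hab).ne'
    · exact absurd heq (hm haI hbI hab).ne
  -- `D` has constant sign on the preconnected square
  have hpre : IsPreconnected (P.gr.sq q) := (convex_closedBall (P.gr.centre q) P.gr.ℓ).isPreconnected
  by_cases hpos : ∀ y ∈ P.gr.sq q, 0 < D y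
  · left
    intro y hy
    rcases P.strictMonoOn_or_strictAntiOn_rayHt hΦ hGτ hτadm hτc hτmono hGc hfit hq hy with hm | hm
    · exact hm
    · exact absurd (hm haI hbI hab) (not_lt.2 (sub_pos.1 (hpos y hy)).le)
  · right
    push Not at hpos
    obtain ⟨y₀, hy₀, hy₀le⟩ := hpos
    have hy₀neg : D y₀ < 0 := lt_of_le_of_ne hy₀le (hDne y₀ hy₀)
    intro y hy
    rcases P.strictMonoOn_or_strictAntiOn_rayHt hΦ hGτ hτadm hτc hτmono hGc hfit hq hy with hm | hm
    · -- `D y > 0` and `D y₀ < 0`: an intermediate zero, contradiction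
      exfalso
      have hyD : 0 < D y := sub_pos.2 (hm haI hbI hab)
      have hmem : (0 : ℝ) ∈ Icc (D y₀) (D y) := ⟨hy₀neg.le, hyD.le⟩
      obtain ⟨z, hz, hz0⟩ := hpre.intermediate_value hy₀ hy hDc hmem
      exact hDne z hz hz0
    · exact hm

variable {R tR : ℝ} (hτR : ∀ x, dist x c₀ = R → τf x = tR) (hqR : (P.gr.sq q ∩ sphere c₀ R).Nonempty)

include hΦ hcl hGτ hτadm hfit hq hτR hqR in
omit [NormedSpace ℝ B] in
/-- **At the ring radius all the ray heights over the square equal the radial height**: the ring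
piece `sphere c₀ R ∩ closedBall c_Q 3ℓ` is preconnected, mapped by `G` leafwise continuously
(level `tR` of the fence) into the box of `Q`. [folklore] -/
theorem rayHt_eq_radialHt_of_ring {y : ℝ × ℝ} (hy : y ∈ P.gr.sq q) :
    height (P.box q) (G (rayPt c₀ y R)) = P.radialHt' c₀ q R := by
  obtain ⟨hne, hℓL, hlo, hhi⟩ := P.levelled_bounds hq
  have hℓ := P.gr.hℓ
  have hyne := hne y hy
  have hcne := hne _ (P.gr.centre_mem_sq q)
  have hRm : R ∈ Icc (dist (P.gr.centre q) c₀ - P.gr.ℓ) (dist (P.gr.centre q) c₀ + P.gr.ℓ) := by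
    obtain ⟨x₀, hx₀, hx₀R⟩ := hqR
    have h := abs_dist_sub_le x₀ (P.gr.centre q) c₀
    rw [mem_sphere.1 hx₀R, abs_le] at h
    have hx₀q : dist x₀ (P.gr.centre q) ≤ P.gr.ℓ := mem_closedBall.1 hx₀
    exact ⟨by linarith [h.1], by linarith [h.2]⟩
  have hR0 : 0 < R := by linarith [hRm.1]
  have hRL : L / 2 ≤ R := by linarith [hRm.1]
  -- the connected ring piece
  set C : Set (ℝ × ℝ) := sphere c₀ R ∩ closedBall (P.gr.centre q) (3 * P.gr.ℓ) with hC
  have h3ℓ : 0 < 3 * P.gr.ℓ := by linarith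
  have hR3 : 3 * P.gr.ℓ < R := by linarith [hRm.1]
  have hCpre : IsPreconnected C := isPreconnected_bigSphere_inter_closedBall h3ℓ hR3
  haveI : PreconnectedSpace C := isPreconnected_iff_preconnectedSpace.1 hCpre
  have hτtR : tR ∈ Ioo (τ₀ - ε) (τ₀ + ε) := by
    obtain ⟨x₀, -, hx₀R⟩ := hqR
    rw [← hτR x₀ (mem_sphere.1 hx₀R)]
    exact hτadm x₀ (by rw [mem_sphere.1 hx₀R]; exact hRL)
  set g₀ : I → F.LeafSpace := toLeafSpace ∘ fun a ↦ Φ a tR with hg₀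
  have hg₀c : Continuous g₀ := hΦ.continuous_toLeafSpace hτtR
  have hg₀01 : g₀ 0 = g₀ 1 := by
    show toLeafSpace (Φ 0 _) = toLeafSpace (Φ 1 _)
    rw [hcl _ hτtR]
  have hGC : ∀ z ∈ C, G z = Φ (angleParam c₀ z) tR := fun z hz ↦ by
    rw [hGτ z (by rw [mem_sphere.1 hz.1]; exact hRL), hτR z (mem_sphere.1 hz.1)]
  have hC0 : C ⊆ {c₀}ᶜ := fun z hz h ↦ by
    have := mem_sphere.1 hz.1
    rw [h, dist_self] at this; linarith
  have hcontC : ContinuousOn (fun z ↦ (toLeafSpace (G z) : F.LeafSpace)) C := by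
    refine ((continuousOn_comp_angleParam hg₀c hg₀01 c₀).mono hC0).congr fun z hz ↦ ?_
    show toLeafSpace (G z) = toLeafSpace (Φ (angleParam c₀ z) _)
    rw [hGC z hz]
  have hgC : Continuous fun k : C ↦ (toLeafSpace (G (k : ℝ × ℝ)) : F.LeafSpace) :=
    continuousOn_iff_continuous_restrict.1 hcontC
  -- every point of `C` is in the big square and within `3ℓ` of the centre: its image is in the source
  have hsrcC : ∀ k : C, ofLeafSpace (toLeafSpace (G (k : ℝ × ℝ)) : F.LeafSpace) ∈ (P.box q).source := by
    intro k
    have hkS : (k : ℝ × ℝ) ∈ P.gr.S := by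
      rw [show P.gr.S = closedBall c₁ L₁ from grid_S hL₁ P.hn, mem_closedBall]
      calc dist (k : ℝ × ℝ) c₁ ≤ dist (k : ℝ × ℝ) c₀ + dist c₀ c₁ := dist_triangle _ _ _
        _ ≤ L₁ := by rw [mem_sphere.1 k.2.1]; linarith [hRm.2]
    obtain ⟨q', hadj, hk⟩ := P.gr.exists_adj_mem_sq_of_dist_le hkS (mem_closedBall.1 k.2.2)
    exact F.subbox_subset_source (P.box_mem q) (P.apply_mem q q' hadj _ hk)
  -- the two ray points are in `C`
  have hyq : dist y (P.gr.centre q) ≤ P.gr.ℓ := mem_closedBall.1 hy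
  have hdy : |dist y c₀ - dist (P.gr.centre q) c₀| ≤ P.gr.ℓ := (abs_dist_sub_le _ _ _).trans hyq
  have h1 : rayPt c₀ y R ∈ C := by
    refine ⟨mem_sphere.2 (dist_rayPt hyne hR0.le), mem_closedBall.2 ?_⟩
    have hzy : dist (rayPt c₀ y R) y ≤ 2 * P.gr.ℓ := by
      rw [dist_rayPt_self hyne, abs_le]
      rw [abs_le] at hdy
      constructor <;> linarith [hRm.1, hRm.2, hdy.1, hdy.2]
    linarith [dist_triangle (rayPt c₀ y R) y (P.gr.centre q)]
  have h2 : rayPt c₀ (P.gr.centre q) R ∈ C := by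
    refine ⟨mem_sphere.2 (dist_rayPt hcne hR0.le), mem_closedBall.2 ?_⟩
    rw [dist_rayPt_self hcne, abs_le]
    constructor <;> linarith [hRm.1, hRm.2]
  exact F.height_eq_of_leafwise (P.box_mem q) hgC hsrcC ⟨_, h1⟩ ⟨_, h2⟩

include hΦ hcl hGτ hτadm hτc hτmono hGc hfit hq hτR hqR in
omit [NormedSpace ℝ B] in
/-- **The sign lemma**: on the boundary of a levelled ring square kept by the skeleton, the
boundary height is below the radial height of the ring exactly inside the ring (or exactly
outside, uniformly), and equals it exactly on the ring. [folklore] -/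
theorem bdryHt_sign_or (hskel : ∀ x ∈ sphere (P.gr.centre q) P.gr.ℓ, P.skel x = G x) :
    (∀ y ∈ sphere (P.gr.centre q) P.gr.ℓ, (P.bdryHt q y < P.radialHt' c₀ q R ↔ dist y c₀ < R) ∧
      (P.bdryHt q y = P.radialHt' c₀ q R ↔ dist y c₀ = R)) ∨
    (∀ y ∈ sphere (P.gr.centre q) P.gr.ℓ, (P.bdryHt q y < P.radialHt' c₀ q R ↔ R < dist y c₀) ∧
      (P.bdryHt q y = P.radialHt' c₀ q R ↔ dist y c₀ = R)) := by
  obtain ⟨hne, hℓL, hlo, hhi⟩ := P.levelled_bounds hq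
  have hℓ := P.gr.hℓ
  have hRm : R ∈ Icc (dist (P.gr.centre q) c₀ - P.gr.ℓ) (dist (P.gr.centre q) c₀ + P.gr.ℓ) := by
    obtain ⟨x₀, hx₀, hx₀R⟩ := hqR
    have h := abs_dist_sub_le x₀ (P.gr.centre q) c₀
    rw [mem_sphere.1 hx₀R, abs_le] at h
    have hx₀q : dist x₀ (P.gr.centre q) ≤ P.gr.ℓ := mem_closedBall.1 hx₀
    exact ⟨by linarith [h.1], by linarith [h.2]⟩
  -- the boundary height at `y` is the ray height at the own distance; the radial height is the ray height at `R`
  have hkey : ∀ y ∈ sphere (P.gr.centre q) P.gr.ℓ, P.bdryHt q y = height (P.box q) (G (rayPt c₀ y (dist y c₀))) ∧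
      P.radialHt' c₀ q R = height (P.box q) (G (rayPt c₀ y R)) ∧
      dist y c₀ ∈ Icc (dist (P.gr.centre q) c₀ - P.gr.ℓ) (dist (P.gr.centre q) c₀ + P.gr.ℓ) := by
    intro y hy
    have hyq : y ∈ P.gr.sq q := P.gr.sphere_subset_sq q hy
    refine ⟨?_, (P.rayHt_eq_radialHt_of_ring hΦ hcl hGτ hτadm hfit hq hτR hqR hyq).symm, ?_⟩
    · rw [P.bdryHt_apply, hskel y hy, rayPt_dist (hne y hyq)]
    · have h := abs_dist_sub_le y (P.gr.centre q) c₀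
      rw [mem_sphere.1 hy, abs_le] at h
      exact ⟨by linarith [h.1], by linarith [h.2]⟩
  rcases P.strictMonoOn_rayHt_or hΦ hGτ hτadm hτc hτmono hGc hfit hq with hm | hm
  · left
    intro y hy
    obtain ⟨h1, h2, hd⟩ := hkey y hy
    have hmy := hm y (P.gr.sphere_subset_sq q hy)
    rw [h1, h2]
    exact ⟨hmy.lt_iff_lt hd hRm, ⟨fun h ↦ hmy.injOn hd hRm h, fun h ↦ by rw [h]⟩⟩
  · right
    intro y hy
    obtain ⟨h1, h2, hd⟩ := hkey y hy
    have hmy := hm y (P.gr.sphere_subset_sq q hy)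
    rw [h1, h2]
    exact ⟨hmy.lt_iff_gt hd hRm, ⟨fun h ↦ hmy.injOn hd hRm h, fun h ↦ by rw [h]⟩⟩

end Levelled

end Foliation.ConePosition

end Literature.Topology.FourManifolds
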